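import Summits.BirchSwinnertonDyer.BirchSwinnertonDyer.Theorems.ResidualThetaTransportAtTwoSignedMuVanishingAtTwoPlusNeronMuChild
import Summits.BirchSwinnertonDyer.BirchSwinnertonDyer.Theorems.ResidualThetaTransportAtTwoCuspSpanEvenAtTwoOdd
import Summits.BirchSwinnertonDyer.BirchSwinnertonDyer.Theorems.ResidualThetaTransportAtTwoSignedMuVanishingAtTwoPlusManinIndex
import Summits.BirchSwinnertonDyer.BirchSwinnertonDyer.Theorems.ResidualThetaTransportAtTwoSignedMuSeedAtTwoPlusPollackPairSupplyHabitat
import Literature.NumberTheory.EllipticCurves.IsogenyIdProofs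
import HarnessLib

/-!
# Route `ResidualThetaTransportAtTwo`, item 21437 `SignedMuAnalyticAtTwoPlus` (the analytic child of the crux Kμ⁺
# `SignedMuVanishingAtTwoPlus`, stmt-BirchSwinnertonDyer-20689): now that the node item 27436 `CuspSpanEvenAtTwoOdd` is
# PROVED, the item IS the period-unit statement at `2` on the habitat⁺ — equivalently «the period ratio `ϖ = Ω⁺_f/Ω_W` is
# `2`-integral», equivalently «the Manin constant of the `X₀(N)`-optimal curve of every habitat⁺ class is odd» (UNCONDITIONAL
# equivalences, no print fact)

Cell `bsd-wall`, width seat `bsd-rtt-w6` (explicit unit keyed on item 21437; `--supports stmt-BirchSwinnertonDyer-21437`,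
closes nothing). THEOREMS ONLY (no `def`, no named fact, no `sorry`); BSD is not proved by any of this, and no Manin-constant
fact (Abbes–Ullmo, Česnavičius) is used anywhere in this file except, by name and as a hypothesis, in the display
corollary at the end of §3.

State of the tree around the item (2026-08-28): the line `birth` of the parent crux proves the item from two stubs, PER
(`stub_periodUnitAtTwo`, closed modulo Abbes–Ullmo Thm. A `abbesUllmo_not_dvd_maninConstant_of_not_dvd_level`) and FLAT
(`stub_flatMuZeroAtTwo`, closed from the node item 27436 `CuspSpanEvenAtTwoOdd`, `flatMuZeroAtTwo_of_cuspSpanEvenAtTwoOdd`,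
p629737); the kernel-exact reading of the item at one curve is rtt-p4-w2's `v₂(ϖ) + μ(L♭_f) = 0`
(`signedMuAnalyticAtTwoPlus_iff_padicValRat_add_mu_eq_zero`, no print fact) and its Manin form `μ(L♭_f) = v₂(c₀)`
(`…ManinIndex`). The node item 27436 `CuspSpanEvenAtTwoOdd` is now a THEOREM (`CuspSpanEvenAtTwoOdd_proof`, rtt-p3-w2 g5
p643713, over rtt-p3-w4's all-odd-rows induction; 2026-08-28T15:07Z), so FLAT holds — `μ(L♭_f) = 0` for every Pollack pair of
every habitat⁺ newform (the lead's `SignedMuAtTwo.flatMuZeroAtTwo`, p643817) — and this file records, UNCONDITIONALLY, what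
the item then IS: it collapses onto the period side ALONE.

* §1 (no node, no print fact) `exists_rat_periodRatio` — for any curve with a newform there IS a rational `ϖ` with
  `ϖ · Ω_W = Ω⁺_f` (so the `∀ ϖ` clause of the item is never vacuous);
  `padicValRat_periodRatio_eq_neg_padicValInt_maninConstant` — with `E[p]` irreducible, for EVERY lattice-optimal datum
  `(W₀, D₀)` isogenous to `W` with the same newform, `v_p(ϖ) = -v_p(c₀)` (`c₀ ∈ ℤ` its Manin constant; odd-degree isogeny
  transport, Greenberg–Vatsal Rem. 3.4); hence `padicValRat_periodRatio_le_zero`: `v₂(ϖ) ≤ 0` — a `2` can sit only in the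
  DENOMINATOR of `ϖ`.
* §2 (node consumed by name) `mu_flat_eq_zero` — `μ(L♭) = 0` for every Pollack pair at `2` of a habitat⁺ newform; and the
  four EXACT READINGS of the item (all `↔`, all unconditional):
  `signedMuAnalyticAtTwoPlus_iff_padicValRat_periodRatio_eq_zero` — ⟺ `v₂(ϖ) = 0` for every habitat⁺ `(W, f, ϖ)`;
  `signedMuAnalyticAtTwoPlus_iff_padicValRat_periodRatio_nonneg` — ⟺ `0 ≤ v₂(ϖ)` («`ϖ` is `2`-integral»: by §1,
  integrality of the `Ω_W`-normalised flat `L`-function `ϖ · L♭_f` is already the whole item — its `μ = 0` is automatic);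
  `signedMuAnalyticAtTwoPlus_iff_periodUnitPlus` — ⟺ PER⁺: `Ω_W = u · Ω⁺_f` with `‖u‖₂ = 1` for every habitat⁺
  `(W, f)` (the registered stub `PeriodUnitAtTwo` of line `birth` restricted to the habitat⁺);
  `signedMuAnalyticAtTwoPlus_iff_odd_maninConstant` — ⟺ for every habitat⁺ `(W, f)` some lattice-optimal datum
  `(W₀, D₀)` at level `N_W` with newform `f`, ISOGENOUS to `W` (a globally minimal model of the strong Weil curve of the
  class), has ODD Manin constant `c₀`.
* §3 the by-name consequences: `not_two_dvd_maninConstant_of_signedMuAnalyticAtTwoPlus` (the item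
  ⟹ `2 ∤ c` for every lattice-optimal datum on a habitat⁺ curve itself),
  `signedMuAnalyticAtTwoPlus_of_forall_not_two_dvd_maninConstant` (the item from Manin-oddness at the habitat⁺ levels
  only — strictly less than Abbes–Ullmo Thm. A, which asserts `p ∤ c` at every level prime to `p`), and the display
  `signedMuAnalyticAtTwoPlus_of_abbesUllmoManinConstantInput` (item 21437 ⟸ the route's by-name input item
  `AbbesUllmoManinConstantInput` ALONE — the lead's `signedMuAnalyticAtTwoPlus_of_abbesUllmo'`, p643817, keyed to the route item).

So item 21437 is EXACTLY «`2 ∤ c₀` for the optimal curve of every habitat⁺ isogeny class» — a case of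
Abbes–Ullmo 1996 Thm. A / Česnavičius 2018 Thm. 1.2 (`p ∤ N ⟹ p ∤ c₀`, here `p = 2`, `N` odd), print but not provable in the
tree today (Néron models); nothing weaker than that print fact can close the item, and nothing stronger is needed.

References: R. Greenberg, V. Vatsal, *On the Iwasawa invariants of elliptic curves*, Invent. Math. 142 (2000), §3 Rem. 3.4
[GreenbergVatsal2000]; B. Edixhoven, *On the Manin constants of modular elliptic curves*, Progr. Math. 89 (1991), Prop. 2, §1
[EdixhovenManin1991]; R. Pollack, Duke Math. J. 118 (2003), Prop. 6.18 [Pollack2003]; A. Abbes, E. Ullmo, Compositio Math.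
103 (1996), Thm. A [AbbesUllmo1996]; K. Česnavičius, Compositio Math. 154 (2018), Thm. 1.2 [Cesnavicius2018].
-/

set_option autoImplicit false
-- justification: the `Summit.BirchSwinnertonDyer.BirchSwinnertonDyer.…` path repeats a component (route-file convention)
set_option linter.dupNamespace false

noncomputable section

open scoped Classical MatrixGroups ModularForm

open CongruenceSubgroup WeierstrassCurve Literature.NumberTheory.EllipticCurves
  Literature.NumberTheory.EllipticCurves.ModularForms Literature.NumberTheory.EllipticCurves.Rank1Residual
  Summit.BirchSwinnertonDyer.Rank1Residual.Supersingular Summit.BirchSwinnertonDyer.Rank1Residual.X1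
  Summit.BirchSwinnertonDyer.BirchSwinnertonDyer.Theses.ResidualThetaTransportAtTwo

namespace Summit.BirchSwinnertonDyer.BirchSwinnertonDyer.Theorems.SignedMuAtTwo.PeriodUnitReading

/-! ## §1. The period ratio: it exists in `ℚ`, and `v_p(ϖ) = -v_p(c₀) ≤ 0` (no node, no print fact) -/

section PeriodRatio

variable {W : WeierstrassCurve ℚ} [W.IsElliptic] [W.IsGloballyMinimal] {N : ℕ} [NeZero N]
  {f : CuspForm (Gamma0 N) 2}

omit [W.IsGloballyMinimal] in
/-- **A rational period ratio exists.** For an elliptic `W/ℚ` with newform `f ∈ S₂(Γ₀(N))` there is `ϖ ∈ ℚ` with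
`ϖ · Ω_W = Ω⁺_f`: a parametrisation datum `D` of `W` exists (`nonempty_modularParametrizationData_of_isNewformOf`), and
`c Λ_f ⊆ Λ_W` read on real parts gives `m · Ω_W = |c| · Ω⁺_f` with `m ≥ 1`, `c ≠ 0` (`realPeriodRat_dvd_holds`); take
`ϖ = m/|c|`. So the `∀ ϖ` clause of item 21437 is never vacuous. [cite: EdixhovenManin1991, §1] -/
theorem exists_rat_periodRatio (hf : IsNewformOf W f) : ∃ ϖ : ℚ, (ϖ : ℝ) * W.realPeriodRat = plusPeriod f := by
  obtain ⟨D⟩ := Literature.NumberTheory.Automorphic.nonempty_modularParametrizationData_of_isNewformOf hf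
  have hDf : D.f = f := D.isNewformOf.unique hf
  subst hDf
  obtain ⟨m, hm0, hm⟩ := D.realPeriodRat_dvd_holds
  have hΩpos : 0 < W.realPeriodRat := W.realPeriodRat_pos_holds
  have hc0 : (|(D.maninConstant : ℝ)| : ℝ) ≠ 0 := by
    intro h0
    rw [h0, zero_mul] at hm
    exact mul_ne_zero (by exact_mod_cast hm0.ne') hΩpos.ne' hm
  refine ⟨(m : ℚ) / |(D.maninConstant : ℚ)|, ?_⟩
  have hcast : (((m : ℚ) / |(D.maninConstant : ℚ)| : ℚ) : ℝ) = (m : ℝ) / |(D.maninConstant : ℝ)| := by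
    push_cast; rfl
  rw [hcast, div_mul_eq_mul_div, hm, mul_div_cancel_left₀ _ hc0]

/-- **`v_p(ϖ) = -v_p(c₀)` along an isogeny to an optimal curve (any prime `p`, `E[p]` irreducible; no Manin fact).** Let
`W/ℚ` be globally minimal with `E[p]` irreducible and newform `f ∈ S₂(Γ₀(N))`, `(W₀, D₀)` a lattice-optimal datum at level `N`
with newform `f` (`Λ_{W₀} = c₀ Λ_f`) on a globally minimal `W₀` ISOGENOUS to `W`, and `ϖ ∈ ℚ` with `ϖ · Ω_W = Ω⁺_f`. Then
`v_p(ϖ) = -v_p(c₀)`: `Ω_{W₀} = |c₀| · Ω⁺_f` exactly (`realPeriodRat_eq_abs_mul_plusPeriod_of_latticeEq`), and along an isogeny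
`W → W₀` of degree prime to `p` (`exists_isogeny_not_dvd_degree_of_irreducible`) `q · Ω_W = a · Ω_{W₀}` with `p ∤ a, q`
(`exists_int_mul_realPeriodRat_eq_of_isogeny`), so `ϖ = q/(a|c₀|)`.
[cite: GreenbergVatsal2000, §3, Remark 3.4] [cite: EdixhovenManin1991, Prop. 2 and §1] -/
theorem padicValRat_periodRatio_eq_neg_padicValInt_maninConstant {p : ℕ} [Fact p.Prime]
    (hirr : W.HasIrreducibleModPGaloisRep p) (hf : IsNewformOf W f) {W₀ : WeierstrassCurve ℚ} [W₀.IsElliptic]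
    [W₀.IsGloballyMinimal] (D₀ : ModularParametrizationData W₀ N) (hD₀ : D₀.f = f)
    (hopt : ∀ z ∈ D₀.L.lattice, ∃ w ∈ periodLattice D₀.f, z = D₀.c * w) (hiso : W.IsIsogenous W₀) {ϖ : ℚ}
    (hϖ : (ϖ : ℝ) * W.realPeriodRat = plusPeriod f) : padicValRat p ϖ = -(padicValInt p D₀.c : ℤ) := by
  have hpP : p.Prime := Fact.out
  subst hD₀
  obtain ⟨D⟩ := Literature.NumberTheory.Automorphic.nonempty_modularParametrizationData_of_isNewformOf hf
  obtain ⟨ψ, hψ⟩ := SkinnerUrban2014.exists_isogeny_not_dvd_degree_of_irreducible (W := W) (W' := W₀)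
    (Nat.cast_ne_zero.mpr hpP.ne_zero) hirr hiso
  obtain ⟨q, a, b, hq0, hqd, hab, hqa⟩ := SkinnerUrban2014.exists_int_mul_realPeriodRat_eq_of_isogeny D D₀ ψ
  have hm := D₀.realPeriodRat_eq_abs_mul_plusPeriod_of_latticeEq hopt
  -- `p ∤ a`, `p ∤ q`, `c₀ ≠ 0`
  have hpa : ¬ (p : ℤ) ∣ a := fun h ↦ hψ (Int.natCast_dvd_natCast.mp (hab ▸ h.mul_right b))
  have hpq : ¬ (p : ℤ) ∣ q := fun h ↦ hψ (Int.natCast_dvd_natCast.mp (h.trans hqd))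
  have hc0 : D₀.c ≠ 0 := by
    intro h0
    rw [h0, Int.cast_zero, abs_zero, zero_mul] at hm
    exact W₀.realPeriodRat_pos_holds.ne' hm
  -- `ϖ · (a |c₀|) = q`
  have hplus : 0 < plusPeriod D₀.f := IsNewform0.plusPeriod_pos_holds hf.1 hf.coeffField_eq_bot
  have hϖeq : (ϖ : ℝ) * ((a : ℝ) * |(D₀.c : ℝ)|) = q := by
    have h1 : (ϖ : ℝ) * ((a : ℝ) * |(D₀.c : ℝ)|) * plusPeriod D₀.f = (q : ℝ) * plusPeriod D₀.f := by
      calc (ϖ : ℝ) * ((a : ℝ) * |(D₀.c : ℝ)|) * plusPeriod D₀.f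
          = (ϖ : ℝ) * ((a : ℝ) * (|(D₀.c : ℝ)| * plusPeriod D₀.f)) := by ring
        _ = (ϖ : ℝ) * ((a : ℝ) * W₀.realPeriodRat) := by rw [hm]
        _ = (ϖ : ℝ) * ((q : ℝ) * W.realPeriodRat) := by rw [hqa]
        _ = (q : ℝ) * ((ϖ : ℝ) * W.realPeriodRat) := by ring
        _ = (q : ℝ) * plusPeriod D₀.f := by rw [hϖ]
    exact mul_right_cancel₀ hplus.ne' h1
  have hϖq : ϖ * ((a : ℚ) * |(D₀.c : ℚ)|) = q := by
    have : ((ϖ * ((a : ℚ) * |(D₀.c : ℚ)|) : ℚ) : ℝ) = (q : ℝ) := by push_cast; exact hϖeq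
    exact_mod_cast this
  have hc0' : (|(D₀.c : ℚ)| : ℚ) ≠ 0 := abs_ne_zero.mpr (Int.cast_ne_zero.mpr hc0)
  have ha0 : (a : ℚ) ≠ 0 := by
    intro ha0
    rw [ha0, zero_mul, mul_zero] at hϖq
    exact hq0 (by exact_mod_cast hϖq.symm)
  have hq0' : (q : ℚ) ≠ 0 := Int.cast_ne_zero.mpr hq0
  have hϖval : ϖ = (q : ℚ) / ((a : ℚ) * |(D₀.c : ℚ)|) := by
    rw [eq_div_iff (mul_ne_zero ha0 hc0'), hϖq]
  -- valuations
  have hva : padicValRat p (a : ℚ) = 0 := by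
    rw [padicValRat.of_int]; exact_mod_cast padicValInt.eq_zero_of_not_dvd hpa
  have hvq : padicValRat p (q : ℚ) = 0 := by
    rw [padicValRat.of_int]; exact_mod_cast padicValInt.eq_zero_of_not_dvd hpq
  have hvc : padicValRat p (|(D₀.c : ℚ)| : ℚ) = padicValInt p D₀.c := by
    rw [← Int.cast_abs, padicValRat.of_int]
    rcases abs_choice D₀.c with h | h <;> rw [h]
    simp [padicValInt, Int.natAbs_neg]
  rw [hϖval, padicValRat.div hq0' (mul_ne_zero ha0 hc0'), padicValRat.mul ha0 hc0', hva, hvq, hvc]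
  ring

/-- **The `2` of the period ratio sits in the denominator** (any prime `p`, `E[p]` irreducible; no Manin fact): for `W/ℚ`
globally minimal with `E[p]` irreducible, newform `f`, and any `ϖ ∈ ℚ` with `ϖ · Ω_W = Ω⁺_f`, `v_p(ϖ) ≤ 0` — by rtt-p4-w2's
`exists_optimalDatum_realPeriodRat_eq_unit_mul_maninConstant_mul_plusPeriod` / `padicValRat_periodIndex_eq_padicValInt_maninConstant`
(`v_p(ϖ⁻¹) = v_p(c₀) ≥ 0`, `c₀ ∈ ℤ` the Manin constant of Edixhoven's optimal datum).
[cite: GreenbergVatsal2000, §3, Remark 3.4] [cite: EdixhovenManin1991, Prop. 2 and §1] -/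
theorem padicValRat_periodRatio_le_zero {p : ℕ} [Fact p.Prime] (hirr : W.HasIrreducibleModPGaloisRep p)
    (hf : IsNewformOf W f) {ϖ : ℚ} (hϖ : (ϖ : ℝ) * W.realPeriodRat = plusPeriod f) : padicValRat p ϖ ≤ 0 := by
  obtain ⟨W₀, hW₀, hW₀', D₀, -, -, u, hu, hΩ⟩ :=
    exists_optimalDatum_realPeriodRat_eq_unit_mul_maninConstant_mul_plusPeriod (p := p) hirr hf
  have hϖ0 : ϖ ≠ 0 := periodRatio_ne_zero hf hϖ
  have hϖ0' : (ϖ : ℝ) ≠ 0 := by exact_mod_cast hϖ0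
  have hΩ' : W.realPeriodRat = (ϖ⁻¹ : ℚ) * plusPeriod f := by
    rw [← hϖ, Rat.cast_inv, ← mul_assoc, inv_mul_cancel₀ hϖ0', one_mul]
  have hv := padicValRat_periodIndex_eq_padicValInt_maninConstant hf hu hΩ hΩ'
  rw [padicValRat.inv] at hv
  omega

omit [W.IsElliptic] [W.IsGloballyMinimal] in
/-- From `v_p(ϖ) = 0` to the period unit: if `ϖ · Ω_W = Ω⁺_f` with `v_p(ϖ) = 0` then `Ω_W = u · Ω⁺_f` with `u = ϖ⁻¹`,
`‖u‖_p = 1`. [folklore] -/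
theorem exists_periodUnit_of_padicValRat_periodRatio_eq_zero {p : ℕ} [Fact p.Prime] (hf : IsNewformOf W f) {ϖ : ℚ}
    (hϖ : (ϖ : ℝ) * W.realPeriodRat = plusPeriod f) (hv : padicValRat p ϖ = 0) :
    ∃ u : ℚ, ‖(u : ℚ_[p])‖ = 1 ∧ W.realPeriodRat = u * plusPeriod f := by
  have hϖ0 : ϖ ≠ 0 := periodRatio_ne_zero hf hϖ
  have hϖ0' : (ϖ : ℝ) ≠ 0 := by exact_mod_cast hϖ0
  have hϖp : (ϖ : ℚ_[p]) ≠ 0 := by exact_mod_cast hϖ0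
  refine ⟨ϖ⁻¹, ?_, ?_⟩
  · have h := Padic.norm_eq_zpow_neg_valuation hϖp
    rw [Padic.valuation_ratCast, hv, neg_zero, zpow_zero] at h
    rw [Rat.cast_inv, norm_inv, h, inv_one]
  · rw [← hϖ, Rat.cast_inv, ← mul_assoc, inv_mul_cancel₀ hϖ0', one_mul]

omit [W.IsGloballyMinimal] in
/-- From the period unit to `v_p(ϖ) = 0` (the tree's `Rank1Residual.padicValRat_periodRatio_eq_zero_of_eq_unit_mul`,
displayed in the shape used below). [cite: GreenbergVatsal2000, §3, Remark 3.4] -/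
theorem padicValRat_periodRatio_eq_zero_of_periodUnit {p : ℕ} [Fact p.Prime]
    (hu : ∃ u : ℚ, ‖(u : ℚ_[p])‖ = 1 ∧ W.realPeriodRat = u * plusPeriod f) {ϖ : ℚ}
    (hϖ : (ϖ : ℝ) * W.realPeriodRat = plusPeriod f) : padicValRat p ϖ = 0 := by
  obtain ⟨u, hu1, hΩ⟩ := hu
  exact Rank1Residual.padicValRat_periodRatio_eq_zero_of_eq_unit_mul W p f hu1 hΩ ϖ hϖ

end PeriodRatio

/-! ## §2. With the node item 27436 proved: `μ(L♭) = 0` on the habitat⁺, and the four exact readings of item 21437 -/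

section Node

/-- **FLAT in `μ`-form (unconditional).** For every habitat⁺ curve `W`, its newform `f` and every Pollack pair `(L♯, L♭)`
at `2`: `μ(L♭) = 0` — `2 ∤ L♭` by `flatMuZeroAtTwo_of_forall_cuspSpanEvenAtTwo` fed with the PROVED node
`CuspSpanEvenAtTwoOdd_proof` (item 27436), and `L♭ ≠ 0`. [cite: Pollack2003, Conj. 6.3 and Prop. 6.18] -/
theorem mu_flat_eq_zero (W : WeierstrassCurve ℚ) [W.IsElliptic]
    [W.IsGloballyMinimal] (hCM : ¬ W.HasCM) (hr : W.analyticRank = 0) (hss : GoodSS W 2) (ha : W.frobeniusTrace 2 = 0)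
    (hΔ : W.Δ < 0) [NeZero (W.conductorNorm ℤ)] {f : CuspForm (Gamma0 (W.conductorNorm ℤ)) 2} (hf : IsNewformOf W f)
    {Lplus Lminus : IwasawaAlgebra 2} (hP : IsPollackPair f 2 Lplus Lminus) : MuLambda.mu Lminus = 0 := by
  have hflat := flatMuZeroAtTwo_of_forall_cuspSpanEvenAtTwo (fun N _ hN ↦ CuspSpanEvenAtTwoOdd_proof N hN) W hCM hr hss
    ha hΔ f hf Lplus Lminus hP
  have h2 : ((2 : ℕ) : ℤ_[2]) = 2 := by norm_num
  rw [mu_eq_zero_iff_not_C_dvd (p := 2) hP.2.1, h2]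
  exact hflat

/-- **EXACT READING 1: item 21437 ⟺ `v₂(ϖ) = 0` on the habitat⁺.** `SignedMuAnalyticAtTwoPlus` holds iff
for every habitat⁺ curve `W`, its newform `f` and every `ϖ ∈ ℚ` with `ϖ · Ω_W = Ω⁺_f`: `v₂(ϖ) = 0`. (Forward: a Pollack pair
exists on the habitat⁺, `SignDichotomy.pollackPairSupplyAtTwo_of_isNewformOf`, and `μ(L♭) = 0` by FLAT; the per-curve
reading `v₂(ϖ) + μ(L♭) = 0` is rtt-p4-w2's `signedMuAnalyticAtTwoPlus_iff_padicValRat_add_mu_eq_zero`.) No Manin fact.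
[cite: GreenbergVatsal2000, p. 2, (2) and §3, Remark 3.4] [cite: Pollack2003, Prop. 6.18] -/
theorem signedMuAnalyticAtTwoPlus_iff_padicValRat_periodRatio_eq_zero :
    SignedMuAnalyticAtTwoPlus ↔
      ∀ (W : WeierstrassCurve ℚ) [W.IsElliptic] [W.IsGloballyMinimal], ¬ W.HasCM →
        W.analyticRank = 0 → GoodSS W 2 → W.frobeniusTrace 2 = 0 → W.Δ < 0 →
        ∀ [NeZero (W.conductorNorm ℤ)] (f : CuspForm (Gamma0 (W.conductorNorm ℤ)) 2), IsNewformOf W f →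
        ∀ (ϖ : ℚ), (ϖ : ℝ) * W.realPeriodRat = plusPeriod f → padicValRat 2 ϖ = 0 := by
  rw [signedMuAnalyticAtTwoPlus_iff_padicValRat_add_mu_eq_zero]
  constructor
  · intro h W _ _ hCM hr hss ha hΔ _ f hf ϖ hϖ
    obtain ⟨Lplus, Lminus, hP⟩ := SignDichotomy.pollackPairSupplyAtTwo_of_isNewformOf W hr hss ha f hf
    have hμ := mu_flat_eq_zero W hCM hr hss ha hΔ hf hP
    have h0 := h W hCM hr hss ha hΔ f hf ϖ hϖ Lplus Lminus hP
    rw [hμ] at h0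
    simpa using h0
  · intro h W _ _ hCM hr hss ha hΔ _ f hf ϖ hϖ Lplus Lminus hP
    rw [mu_flat_eq_zero W hCM hr hss ha hΔ hf hP, h W hCM hr hss ha hΔ f hf ϖ hϖ]
    simp

/-- **EXACT READING 2: `2`-INTEGRALITY of `ϖ` suffices.** `SignedMuAnalyticAtTwoPlus` holds iff for every
habitat⁺ `(W, f, ϖ)`: `0 ≤ v₂(ϖ)` — because `v₂(ϖ) ≤ 0` always (§1; `E[2]` is irreducible at a good supersingular `2`,
`P2.irr_two_of_goodSS_two`). In words: the item's «`ϖ · L⁺_W` is `2`-integral with `μ = 0`» is already implied by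
«`ϖ · L⁺_W` is `2`-integral». [cite: GreenbergVatsal2000, §3, Remark 3.4] [cite: EdixhovenManin1991, Prop. 2 and §1] -/
theorem signedMuAnalyticAtTwoPlus_iff_padicValRat_periodRatio_nonneg :
    SignedMuAnalyticAtTwoPlus ↔
      ∀ (W : WeierstrassCurve ℚ) [W.IsElliptic] [W.IsGloballyMinimal], ¬ W.HasCM →
        W.analyticRank = 0 → GoodSS W 2 → W.frobeniusTrace 2 = 0 → W.Δ < 0 →
        ∀ [NeZero (W.conductorNorm ℤ)] (f : CuspForm (Gamma0 (W.conductorNorm ℤ)) 2), IsNewformOf W f →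
        ∀ (ϖ : ℚ), (ϖ : ℝ) * W.realPeriodRat = plusPeriod f → 0 ≤ padicValRat 2 ϖ := by
  rw [signedMuAnalyticAtTwoPlus_iff_padicValRat_periodRatio_eq_zero]
  constructor
  · intro h W _ _ hCM hr hss ha hΔ _ f hf ϖ hϖ
    exact (h W hCM hr hss ha hΔ f hf ϖ hϖ).ge
  · intro h W _ _ hCM hr hss ha hΔ _ f hf ϖ hϖ
    exact le_antisymm (padicValRat_periodRatio_le_zero (Rank1Residual.P2.irr_two_of_goodSS_two W hss) hf hϖ)
      (h W hCM hr hss ha hΔ f hf ϖ hϖ)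

/-- **EXACT READING 3: item 21437 ⟺ PER⁺**, the period unit at `2` on the habitat⁺: for every habitat⁺
curve `W` and its newform `f`, `Ω_W = u · Ω⁺_f` with `u ∈ ℚ`, `‖u‖₂ = 1` — the registered stub `PeriodUnitAtTwo` of line
`birth` with the habitat⁺ binders added (that stub asks it for every curve good supersingular at `2`). The `ϖ`-clause is
inhabited by §1 `exists_rat_periodRatio`. [cite: GreenbergVatsal2000, §3, Remark 3.4] [cite: Pollack2003, Prop. 6.18] -/
theorem signedMuAnalyticAtTwoPlus_iff_periodUnitPlus :
    SignedMuAnalyticAtTwoPlus ↔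
      ∀ (W : WeierstrassCurve ℚ) [W.IsElliptic] [W.IsGloballyMinimal], ¬ W.HasCM →
        W.analyticRank = 0 → GoodSS W 2 → W.frobeniusTrace 2 = 0 → W.Δ < 0 →
        ∀ [NeZero (W.conductorNorm ℤ)] (f : CuspForm (Gamma0 (W.conductorNorm ℤ)) 2), IsNewformOf W f →
        ∃ u : ℚ, ‖(u : ℚ_[2])‖ = 1 ∧ W.realPeriodRat = u * plusPeriod f := by
  rw [signedMuAnalyticAtTwoPlus_iff_padicValRat_periodRatio_eq_zero]
  constructor
  · intro h W _ _ hCM hr hss ha hΔ _ f hf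
    obtain ⟨ϖ, hϖ⟩ := exists_rat_periodRatio hf
    exact exists_periodUnit_of_padicValRat_periodRatio_eq_zero hf hϖ (h W hCM hr hss ha hΔ f hf ϖ hϖ)
  · intro h W _ _ hCM hr hss ha hΔ _ f hf ϖ hϖ
    exact padicValRat_periodRatio_eq_zero_of_periodUnit (h W hCM hr hss ha hΔ f hf) hϖ

/-- **EXACT READING 4: item 21437 ⟺ ODD MANIN CONSTANT of the optimal curve of every habitat⁺ class.**
`SignedMuAnalyticAtTwoPlus` holds iff for every habitat⁺ curve `W` with newform `f` there is a lattice-optimal datum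
`(W₀, D₀)` at level `N_W` with newform `f` (`Λ_{W₀} = c₀ Λ_f`) on a globally minimal `W₀` isogenous to `W` — a minimal model
of the strong Weil curve of the class (Edixhoven: `exists_optimalDatum_of_edixhoven`) — whose Manin constant `c₀` is ODD.
Both directions through §1's `v₂(ϖ) = -v₂(c₀)`. Abbes–Ullmo 1996 Thm. A / Česnavičius 2018 Thm. 1.2 print the right-hand
side (`2 ∤ N_W` on the habitat); they are NOT used here.
[cite: GreenbergVatsal2000, §3, Remark 3.4] [cite: EdixhovenManin1991, Prop. 2 and §1] [cite: Pollack2003, Prop. 6.18] -/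
theorem signedMuAnalyticAtTwoPlus_iff_odd_maninConstant :
    SignedMuAnalyticAtTwoPlus ↔
      ∀ (W : WeierstrassCurve ℚ) [W.IsElliptic] [W.IsGloballyMinimal], ¬ W.HasCM →
        W.analyticRank = 0 → GoodSS W 2 → W.frobeniusTrace 2 = 0 → W.Δ < 0 →
        ∀ [NeZero (W.conductorNorm ℤ)] (f : CuspForm (Gamma0 (W.conductorNorm ℤ)) 2), IsNewformOf W f →
        ∃ (W₀ : WeierstrassCurve ℚ) (_ : W₀.IsElliptic) (_ : W₀.IsGloballyMinimal)
          (D₀ : ModularParametrizationData W₀ (W.conductorNorm ℤ)), D₀.f = f ∧ W.IsIsogenous W₀ ∧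
          (∀ z ∈ D₀.L.lattice, ∃ w ∈ periodLattice D₀.f, z = D₀.c * w) ∧ ¬ (2 : ℤ) ∣ D₀.maninConstant := by
  rw [signedMuAnalyticAtTwoPlus_iff_padicValRat_periodRatio_eq_zero]
  constructor
  · intro h W _ _ hCM hr hss ha hΔ _ f hf
    -- Edixhoven's optimal datum, isogenous to `W`
    obtain ⟨D⟩ := Literature.NumberTheory.Automorphic.nonempty_modularParametrizationData_of_isNewformOf hf
    have hDf : D.f = f := D.isNewformOf.unique hf
    obtain ⟨W₀, hW₀, hW₀', D₀, hf₀, hiso, hopt, -⟩ :=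
      D.exists_optimalDatum_of_edixhoven
        (fun hf' hL' q hq hq' ↦ edixhoven_int_of_neronLattice_eq_smul_periodLattice_holds hf' hL' q hq hq')
    rw [hDf] at hf₀
    refine ⟨W₀, hW₀, hW₀', D₀, hf₀, hiso, hopt, ?_⟩
    obtain ⟨ϖ, hϖ⟩ := exists_rat_periodRatio hf
    have hv := padicValRat_periodRatio_eq_neg_padicValInt_maninConstant (p := 2)
      (Rank1Residual.P2.irr_two_of_goodSS_two W hss) hf D₀ hf₀ hopt hiso hϖ
    rw [h W hCM hr hss ha hΔ f hf ϖ hϖ] at hv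
    have hc0 : D₀.c ≠ 0 := by
      intro h0
      have hm := D₀.realPeriodRat_eq_abs_mul_plusPeriod_of_latticeEq hopt
      rw [h0, Int.cast_zero, abs_zero, zero_mul] at hm
      exact W₀.realPeriodRat_pos_holds.ne' hm
    have hval : padicValInt 2 D₀.c = 0 := by omega
    rcases padicValInt.eq_zero_iff.mp hval with h2 | h0 | hndvd
    · exact absurd h2 (by norm_num)
    · exact absurd h0 hc0
    · exact hndvd
  · intro h W _ _ hCM hr hss ha hΔ _ f hf ϖ hϖ
    obtain ⟨W₀, hW₀, hW₀', D₀, hf₀, hiso, hopt, hodd⟩ := h W hCM hr hss ha hΔ f hf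
    have hv := padicValRat_periodRatio_eq_neg_padicValInt_maninConstant (p := 2)
      (Rank1Residual.P2.irr_two_of_goodSS_two W hss) hf D₀ hf₀ hopt hiso hϖ
    have hval : padicValInt 2 D₀.c = 0 := padicValInt.eq_zero_of_not_dvd (by exact_mod_cast hodd)
    rw [hv, hval]
    simp

end Node

/-! ## §3. The item in Manin-constant language, both directions by name -/

section Manin

/-- **Item 21437 ⟹ odd Manin constant on the habitat⁺.** If `SignedMuAnalyticAtTwoPlus` holds then for
every habitat⁺ curve `W` and every lattice-optimal datum `D` ON `W` at level `N_W` (`Λ_W = c Λ_{f}`: `W` is a globally minimal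
model of the strong Weil curve), the Manin constant `c` is odd: `Ω_W = |c| · Ω⁺_f` exactly
(`realPeriodRat_eq_abs_mul_plusPeriod_of_latticeEq`), so `ϖ = 1/|c|` and reading 1 gives `v₂(c) = 0`.
[cite: EdixhovenManin1991, Prop. 2 and §1] [cite: GreenbergVatsal2000, §3, Remark 3.4] -/
theorem not_two_dvd_maninConstant_of_signedMuAnalyticAtTwoPlus (h : SignedMuAnalyticAtTwoPlus)
    (W : WeierstrassCurve ℚ) [W.IsElliptic] [W.IsGloballyMinimal] (hCM : ¬ W.HasCM)
    (hr : W.analyticRank = 0) (hss : GoodSS W 2) (ha : W.frobeniusTrace 2 = 0) (hΔ : W.Δ < 0)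
    [NeZero (W.conductorNorm ℤ)] (D : ModularParametrizationData W (W.conductorNorm ℤ))
    (hopt : ∀ z ∈ D.L.lattice, ∃ w ∈ periodLattice D.f, z = D.c * w) : ¬ (2 : ℤ) ∣ D.maninConstant := by
  obtain ⟨ϖ, hϖ⟩ := exists_rat_periodRatio D.isNewformOf
  have hv := padicValRat_periodRatio_eq_neg_padicValInt_maninConstant (p := 2)
    (Rank1Residual.P2.irr_two_of_goodSS_two W hss) D.isNewformOf D rfl hopt (WeierstrassCurve.isIsogenous_self W) hϖ
  rw [signedMuAnalyticAtTwoPlus_iff_padicValRat_periodRatio_eq_zero.mp h W hCM hr hss ha hΔ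
    D.f D.isNewformOf ϖ hϖ] at hv
  have hc0 : D.c ≠ 0 := by
    intro h0
    have hm := D.realPeriodRat_eq_abs_mul_plusPeriod_of_latticeEq hopt
    rw [h0, Int.cast_zero, abs_zero, zero_mul] at hm
    exact W.realPeriodRat_pos_holds.ne' hm
  have hval : padicValInt 2 D.c = 0 := by omega
  rcases padicValInt.eq_zero_iff.mp hval with h2 | h0 | hndvd
  · exact absurd h2 (by norm_num)
  · exact absurd h0 hc0
  · exact hndvd

/-- **Odd Manin constants at the habitat⁺ levels ⟹ item 21437.** If for every habitat⁺ curve `W` with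
newform `f`, every lattice-optimal datum `(W₀, D₀)` at level `N_W` with newform `f` has odd Manin constant, then
`SignedMuAnalyticAtTwoPlus` holds (`exists_periodUnit_of_forall_optimal_not_dvd_maninConstant` + reading 3). The hypothesis is
Abbes–Ullmo Thm. A RESTRICTED to the habitat⁺ newforms (the tree fact `abbesUllmo_not_dvd_maninConstant_of_not_dvd_level`
asserts it at every level prime to `p`, for every `p`). [cite: AbbesUllmo1996, Thm. A] [cite: GreenbergVatsal2000, §3, Remark 3.4] -/
theorem signedMuAnalyticAtTwoPlus_of_forall_not_two_dvd_maninConstant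
    (hc : ∀ (W : WeierstrassCurve ℚ) [W.IsElliptic] [W.IsGloballyMinimal], ¬ W.HasCM → W.analyticRank = 0 →
      GoodSS W 2 → W.frobeniusTrace 2 = 0 → W.Δ < 0 →
      ∀ [NeZero (W.conductorNorm ℤ)] (f : CuspForm (Gamma0 (W.conductorNorm ℤ)) 2), IsNewformOf W f →
      ∀ (W₀ : WeierstrassCurve ℚ) [W₀.IsElliptic] [W₀.IsGloballyMinimal]
        (D₀ : ModularParametrizationData W₀ (W.conductorNorm ℤ)), D₀.f = f →
        (∀ z ∈ D₀.L.lattice, ∃ w ∈ periodLattice D₀.f, z = D₀.c * w) → ¬ (2 : ℤ) ∣ D₀.maninConstant) :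
    SignedMuAnalyticAtTwoPlus := by
  refine signedMuAnalyticAtTwoPlus_iff_periodUnitPlus.mpr ?_
  intro W _ _ hCM hr hss ha hΔ _ f hf
  exact exists_periodUnit_of_forall_optimal_not_dvd_maninConstant (p := 2)
    (Rank1Residual.P2.irr_two_of_goodSS_two W hss) hf
    fun W₀ _ _ D₀ hD₀ hopt ↦ by exact_mod_cast hc W hCM hr hss ha hΔ f hf W₀ D₀ hD₀ hopt

/-- **The route's by-name input item `AbbesUllmoManinConstantInput` (= the Abbes–Ullmo fact) ⟹ item 21437** — the lead's
`signedMuAnalyticAtTwoPlus_of_abbesUllmo'` (p643817) keyed to the ROUTE ITEM: with the node closed, the Abbes–Ullmo input is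
the item's only remaining hypothesis (and, by reading 4, exactly as strong as the item on the habitat⁺ levels). Conditional on
the print fact. [cite: AbbesUllmo1996, Thm. A] -/
theorem signedMuAnalyticAtTwoPlus_of_abbesUllmoManinConstantInput (hAU : AbbesUllmoManinConstantInput) :
    SignedMuAnalyticAtTwoPlus :=
  signedMuAnalyticAtTwoPlus_of_abbesUllmo_of_forall_cuspSpanEvenAtTwo hAU fun N _ hN ↦ CuspSpanEvenAtTwoOdd_proof N hN

end Manin

end Summit.BirchSwinnertonDyer.BirchSwinnertonDyer.Theorems.SignedMuAtTwo.PeriodUnitReading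

end
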